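import Summits.HodgeConjecture.HodgeCM.Automorphic.SchwartzLinearFlowDeriv_1

/-! PORT of `HodgeCM/Automorphic/SchwartzLinearFlowDeriv.lean` (HodgeCMPerL run 81) — part 2: continuation of `Summits.HodgeConjecture.HodgeCM.Automorphic.SchwartzLinearFlowDeriv_1` (split at a top-level declaration boundary by port_pkg.py; scope re-opened below; declarations unchanged). -/

-- port_pkg: scope re-opened for this part (file-level context, then the namespace/section stack open at the cut)
noncomputable section
open scoped SchwartzMap Topology
open Filter Set Metric
namespace HodgeCM
namespace SchwartzWeil
variable {E F : Type*} [NormedAddCommGroup E] [NormedSpace ℝ E] [NormedAddCommGroup F] [NormedSpace ℝ F]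
/-- **Smooth vectors for linear flows.**  Let `L : ℝ → (E ≃L[ℝ] E)` satisfy `L 0 = 1` and be differentiable at
`0` in operator norm with derivative `A`.  Then for every `Φ ∈ 𝓢(E, F)` the difference quotients
`s⁻¹ • (Φ ∘ L s - Φ)` converge to `flowGen A Φ = (x ↦ DΦ(x)(A x))` **in the Schwartz topology** as `s → 0`. -/
theorem tendsto_compCLM_sub_div (𝕜 : Type*) [RCLike 𝕜] [NormedSpace 𝕜 F] [SMulCommClass ℝ 𝕜 F]
    {L : ℝ → (E ≃L[ℝ] E)} {A : E →L[ℝ] E} (hL0 : ((L 0 : E ≃L[ℝ] E) : E →L[ℝ] E) = 1)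
    (hL : HasDerivAt (fun s => ((L s : E ≃L[ℝ] E) : E →L[ℝ] E)) A 0) (Φ : 𝓢(E, F)) :
    Tendsto (fun s : ℝ => s⁻¹ • (SchwartzMap.compCLMOfContinuousLinearEquiv 𝕜 (L s) Φ - Φ))
      (𝓝[≠] 0) (𝓝 (flowGen A Φ)) := by
  -- operator-norm facts about the family `L`
  have hslope : Tendsto (fun s : ℝ => s⁻¹ • (((L s : E ≃L[ℝ] E) : E →L[ℝ] E) - 1)) (𝓝[≠] 0) (𝓝 A) := by
    have h := hasDerivAt_iff_tendsto_slope_zero.mp hL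
    simpa only [zero_add, hL0] using h
  have hcont : Tendsto (fun s : ℝ => ((L s : E ≃L[ℝ] E) : E →L[ℝ] E) - 1) (𝓝[≠] 0) (𝓝 0) := by
    have h : Tendsto (fun s : ℝ => ((L s : E ≃L[ℝ] E) : E →L[ℝ] E)) (𝓝 0) (𝓝 1) := by
      have := hL.continuousAt.tendsto
      rwa [hL0] at this
    exact (tendsto_sub_nhds_zero_iff.2 h).mono_left nhdsWithin_le_nhds
  have hsmall : ∀ᶠ s in 𝓝[≠] (0 : ℝ), ‖((L s : E ≃L[ℝ] E) : E →L[ℝ] E) - 1‖ ≤ 1 / 2 := by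
    have h := hcont.norm
    rw [norm_zero] at h
    exact ((tendsto_order.1 h).2 (1 / 2) (by norm_num)).mono fun s hs => hs.le
  have hδ : Tendsto (fun s : ℝ => ‖s⁻¹ • (((L s : E ≃L[ℝ] E) : E →L[ℝ] E) - 1) - A‖) (𝓝[≠] 0) (𝓝 0) := by
    have h := (tendsto_sub_nhds_zero_iff.2 hslope).norm
    rwa [norm_zero] at h
  have hbig : ∀ᶠ s in 𝓝[≠] (0 : ℝ), ‖((L s : E ≃L[ℝ] E) : E →L[ℝ] E) - 1‖ ≤ (‖A‖ + 1) * |s| := by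
    have h1 : ∀ᶠ s in 𝓝[≠] (0 : ℝ), ‖s⁻¹ • (((L s : E ≃L[ℝ] E) : E →L[ℝ] E) - 1) - A‖ < 1 :=
      (tendsto_order.1 hδ).2 1 one_pos
    filter_upwards [h1, self_mem_nhdsWithin] with s hs hs0
    have hs0' : s ≠ 0 := hs0
    have hspos : 0 < |s| := abs_pos.2 hs0'
    have h2 : ‖s⁻¹ • (((L s : E ≃L[ℝ] E) : E →L[ℝ] E) - 1)‖ ≤ ‖A‖ + 1 := by
      have := norm_le_norm_add_norm_sub' (s⁻¹ • (((L s : E ≃L[ℝ] E) : E →L[ℝ] E) - 1)) A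
      linarith
    rw [norm_smul, norm_inv, Real.norm_eq_abs] at h2
    calc ‖((L s : E ≃L[ℝ] E) : E →L[ℝ] E) - 1‖
        = |s| * (|s|⁻¹ * ‖((L s : E ≃L[ℝ] E) : E →L[ℝ] E) - 1‖) := by field_simp
      _ ≤ |s| * (‖A‖ + 1) := by gcongr
      _ = (‖A‖ + 1) * |s| := mul_comm _ _
  -- the engine
  refine tendsto_of_seminorm_bounded_of_uniform (fun k n => ?_) (fun ε hε => ?_)
  · -- (hb) Schwartz seminorms of the difference quotients stay bounded
    set K : ℝ := 2 ^ (n + k + 1) * SchwartzMap.seminorm ℝ (k + 1) (n + 1) Φ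
      + n * 2 ^ n * SchwartzMap.seminorm ℝ k n Φ with hK
    have hK0 : 0 ≤ K :=
      add_nonneg (mul_nonneg (pow_nonneg (by norm_num) _) (apply_nonneg _ _))
        (mul_nonneg (mul_nonneg (Nat.cast_nonneg n) (pow_nonneg (by norm_num) _)) (apply_nonneg _ _))
    refine ⟨K * (‖A‖ + 1), ?_⟩
    filter_upwards [hsmall, hbig, self_mem_nhdsWithin] with s hs1 hs2 hs0
    have hs0' : s ≠ 0 := hs0
    have hspos : 0 < |s| := abs_pos.2 hs0'
    have hsem := seminorm_compCLM_sub_le Φ 𝕜 (L s) hs1 k n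
    rw [map_smul_eq_mul, norm_inv, Real.norm_eq_abs]
    calc |s|⁻¹ * SchwartzMap.seminorm ℝ k n (SchwartzMap.compCLMOfContinuousLinearEquiv 𝕜 (L s) Φ - Φ)
        ≤ |s|⁻¹ * (K * ((‖A‖ + 1) * |s|)) := by
          gcongr
          exact hsem.trans (mul_le_mul_of_nonneg_left hs2 hK0)
      _ = K * (‖A‖ + 1) := by field_simp
  · -- (h0) uniform convergence of the difference quotients
    have hp11 : 0 ≤ SchwartzMap.seminorm ℝ 1 1 Φ := apply_nonneg _ _
    have hp22 : 0 ≤ SchwartzMap.seminorm ℝ 2 2 Φ := apply_nonneg _ _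
    have habs : Tendsto (fun s : ℝ => |s|) (𝓝[≠] 0) (𝓝 0) :=
      (continuous_abs.tendsto' (0 : ℝ) 0 abs_zero).mono_left nhdsWithin_le_nhds
    have t1 : Tendsto (fun s : ℝ => 4 * SchwartzMap.seminorm ℝ 2 2 Φ * (‖A‖ + 1) ^ 2 * |s|)
        (𝓝[≠] 0) (𝓝 0) := by
      simpa using habs.const_mul (4 * SchwartzMap.seminorm ℝ 2 2 Φ * (‖A‖ + 1) ^ 2)
    have t2 : Tendsto (fun s : ℝ => SchwartzMap.seminorm ℝ 1 1 Φ
        * ‖s⁻¹ • (((L s : E ≃L[ℝ] E) : E →L[ℝ] E) - 1) - A‖) (𝓝[≠] 0) (𝓝 0) := by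
      simpa using hδ.const_mul (SchwartzMap.seminorm ℝ 1 1 Φ)
    have e1 := (tendsto_order.1 t1).2 (ε / 2) (by positivity)
    have e2 := (tendsto_order.1 t2).2 (ε / 2) (by positivity)
    filter_upwards [hsmall, hbig, self_mem_nhdsWithin, e1, e2] with s hs1 hs2 hs0 h1 h2
    have hs0' : s ≠ 0 := hs0
    have hspos : 0 < |s| := abs_pos.2 hs0'
    intro x
    -- abbreviations
    set Lc : E →L[ℝ] E := ((L s : E ≃L[ℝ] E) : E →L[ℝ] E) with hLc
    have hLx : (L s) x = Lc x := rfl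
    have hq : (s⁻¹ • (SchwartzMap.compCLMOfContinuousLinearEquiv 𝕜 (L s) Φ - Φ)) x - flowGen A Φ x
        = s⁻¹ • (Φ (Lc x) - Φ x - fderiv ℝ Φ x (Lc x - x))
          + fderiv ℝ Φ x ((s⁻¹ • (Lc - 1) - A) x) := by
      rw [smul_apply, sub_apply, SchwartzMap.compCLMOfContinuousLinearEquiv_apply, Function.comp_apply,
        flowGen_apply, hLx]
      simp only [sub_apply, smul_apply, one_apply_eq_self, map_sub, map_smul, smul_sub]
      abel
    rw [hq]
    have hTaylor := norm_comp_sub_sub_fderiv_le Φ hs1 x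
    have h11 := norm_mul_norm_fderiv_le Φ x
    calc ‖s⁻¹ • (Φ (Lc x) - Φ x - fderiv ℝ Φ x (Lc x - x)) + fderiv ℝ Φ x ((s⁻¹ • (Lc - 1) - A) x)‖
        ≤ ‖s⁻¹ • (Φ (Lc x) - Φ x - fderiv ℝ Φ x (Lc x - x))‖
            + ‖fderiv ℝ Φ x ((s⁻¹ • (Lc - 1) - A) x)‖ := norm_add_le _ _
      _ ≤ |s|⁻¹ * (4 * SchwartzMap.seminorm ℝ 2 2 Φ * ‖Lc - 1‖ ^ 2)
            + ‖fderiv ℝ (Φ : E → F) x‖ * (‖s⁻¹ • (Lc - 1) - A‖ * ‖x‖) := by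
          refine add_le_add ?_ ?_
          · rw [norm_smul, norm_inv, Real.norm_eq_abs]
            exact mul_le_mul_of_nonneg_left hTaylor (inv_nonneg.2 hspos.le)
          · exact (ContinuousLinearMap.le_opNorm _ _).trans
              (mul_le_mul_of_nonneg_left (ContinuousLinearMap.le_opNorm _ _) (norm_nonneg _))
      _ ≤ |s|⁻¹ * (4 * SchwartzMap.seminorm ℝ 2 2 Φ * ((‖A‖ + 1) * |s|) ^ 2)
            + SchwartzMap.seminorm ℝ 1 1 Φ * ‖s⁻¹ • (Lc - 1) - A‖ := by
          refine add_le_add ?_ ?_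
          · refine mul_le_mul_of_nonneg_left ?_ (inv_nonneg.2 hspos.le)
            exact mul_le_mul_of_nonneg_left (pow_le_pow_left₀ (norm_nonneg _) hs2 2) (by linarith)
          · calc ‖fderiv ℝ (Φ : E → F) x‖ * (‖s⁻¹ • (Lc - 1) - A‖ * ‖x‖)
                = ‖s⁻¹ • (Lc - 1) - A‖ * (‖x‖ * ‖fderiv ℝ (Φ : E → F) x‖) := by ring
              _ ≤ ‖s⁻¹ • (Lc - 1) - A‖ * SchwartzMap.seminorm ℝ 1 1 Φ :=
                  mul_le_mul_of_nonneg_left h11 (norm_nonneg _)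
              _ = SchwartzMap.seminorm ℝ 1 1 Φ * ‖s⁻¹ • (Lc - 1) - A‖ := mul_comm _ _
      _ = 4 * SchwartzMap.seminorm ℝ 2 2 Φ * (‖A‖ + 1) ^ 2 * |s|
            + SchwartzMap.seminorm ℝ 1 1 Φ * ‖s⁻¹ • (Lc - 1) - A‖ := by
          field_simp
      _ ≤ ε / 2 + ε / 2 := add_le_add h1.le h2.le
      _ = ε := by ring

/-! ## Base points, functionals, complex scalars -/

section Consequences

variable (𝕜 : Type*) [RCLike 𝕜] [NormedSpace 𝕜 F] [SMulCommClass ℝ 𝕜 F]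
  {L : ℝ → (E ≃L[ℝ] E)} {A : E →L[ℝ] E}

/-- Base-point version for a family with the flow property `L (s₀ + s) = L s₀ ∘ L s` (e.g. a one-parameter
group): the difference quotients at `s₀` converge in `𝓢(E, F)` to `flowGen A (Φ ∘ L s₀)`. -/
theorem tendsto_compCLM_sub_div_at (hL0 : ((L 0 : E ≃L[ℝ] E) : E →L[ℝ] E) = 1)
    (hL : HasDerivAt (fun s => ((L s : E ≃L[ℝ] E) : E →L[ℝ] E)) A 0)
    (hmul : ∀ s t x, L (s + t) x = L s (L t x)) (Φ : 𝓢(E, F)) (s₀ : ℝ) :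
    Tendsto (fun s : ℝ => s⁻¹ • (SchwartzMap.compCLMOfContinuousLinearEquiv 𝕜 (L (s₀ + s)) Φ
        - SchwartzMap.compCLMOfContinuousLinearEquiv 𝕜 (L s₀) Φ)) (𝓝[≠] 0)
      (𝓝 (flowGen A (SchwartzMap.compCLMOfContinuousLinearEquiv 𝕜 (L s₀) Φ))) := by
  have key : ∀ s, SchwartzMap.compCLMOfContinuousLinearEquiv 𝕜 (L (s₀ + s)) Φ
      = SchwartzMap.compCLMOfContinuousLinearEquiv 𝕜 (L s)
          (SchwartzMap.compCLMOfContinuousLinearEquiv 𝕜 (L s₀) Φ) := by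
    intro s
    ext x
    simp [hmul]
  simp only [key]
  exact tendsto_compCLM_sub_div 𝕜 hL0 hL _

/-- **Differentiability of matrix coefficients along linear flows.**  For every continuous `ℝ`-linear map
`T : 𝓢(E, F) →L[ℝ] G` (a tempered functional, a continuous operator into a normed space, …) and every `s₀`,
`s ↦ T (Φ ∘ L s)` is differentiable at `s₀` with derivative `T (flowGen A (Φ ∘ L s₀))`. -/
theorem hasDerivAt_apply_compCLM {G : Type*} [NormedAddCommGroup G] [NormedSpace ℝ G]
    (T : 𝓢(E, F) →L[ℝ] G) (hL0 : ((L 0 : E ≃L[ℝ] E) : E →L[ℝ] E) = 1)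
    (hL : HasDerivAt (fun s => ((L s : E ≃L[ℝ] E) : E →L[ℝ] E)) A 0)
    (hmul : ∀ s t x, L (s + t) x = L s (L t x)) (Φ : 𝓢(E, F)) (s₀ : ℝ) :
    HasDerivAt (fun s => T (SchwartzMap.compCLMOfContinuousLinearEquiv 𝕜 (L s) Φ))
      (T (flowGen A (SchwartzMap.compCLMOfContinuousLinearEquiv 𝕜 (L s₀) Φ))) s₀ := by
  rw [hasDerivAt_iff_tendsto_slope_zero]
  have h := (T.continuous.tendsto _).comp (tendsto_compCLM_sub_div_at 𝕜 hL0 hL hmul Φ s₀)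
  refine h.congr fun s => ?_
  simp only [Function.comp_apply, map_smul, map_sub]

end Consequences

/-- The complex-scalar form used for `ℂ`-valued Schwartz functions:
`((s : ℂ))⁻¹ • (Φ ∘ L s - Φ) → flowGen A Φ` in `𝓢(E, F)`. -/
theorem tendsto_compCLM_sub_div_ofReal {F : Type*} [NormedAddCommGroup F] [NormedSpace ℝ F]
    [NormedSpace ℂ F] [IsScalarTower ℝ ℂ F] [SMulCommClass ℝ ℂ F]
    {L : ℝ → (E ≃L[ℝ] E)} {A : E →L[ℝ] E} (hL0 : ((L 0 : E ≃L[ℝ] E) : E →L[ℝ] E) = 1)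
    (hL : HasDerivAt (fun s => ((L s : E ≃L[ℝ] E) : E →L[ℝ] E)) A 0) (Φ : 𝓢(E, F)) :
    Tendsto (fun s : ℝ => ((s : ℂ))⁻¹ • (SchwartzMap.compCLMOfContinuousLinearEquiv ℂ (L s) Φ - Φ))
      (𝓝[≠] 0) (𝓝 (flowGen A Φ)) := by
  refine (tendsto_compCLM_sub_div ℂ hL0 hL Φ).congr fun s => ?_
  rw [← Complex.ofReal_inv, show ((s⁻¹ : ℝ) : ℂ) = (s⁻¹ : ℝ) • (1 : ℂ) by rw [Complex.real_smul, mul_one],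
    smul_one_smul]

/-! ## Example: dilations `x ↦ e^s x` and the Euler operator `x · ∇` -/

section Dilation

variable (E)

/-- The dilation `x ↦ e^s • x` as a continuous linear automorphism of `E`. -/
def dilation (s : ℝ) : E ≃L[ℝ] E :=
  ContinuousLinearEquiv.unitsEquiv ℝ E
    ⟨Real.exp s • 1, Real.exp (-s) • 1,
      by rw [smul_mul_smul_comm, mul_one, ← Real.exp_add, add_neg_cancel, Real.exp_zero, one_smul],
      by rw [smul_mul_smul_comm, mul_one, ← Real.exp_add, neg_add_cancel, Real.exp_zero, one_smul]⟩

/-- (Ported verbatim from the HodgeCMPerL package; no docstring in the source.) -/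
@[simp] theorem dilation_apply (s : ℝ) (x : E) : dilation E s x = Real.exp s • x := rfl

/-- (Ported verbatim from the HodgeCMPerL package; no docstring in the source.) -/
theorem coe_dilation (s : ℝ) : ((dilation E s : E ≃L[ℝ] E) : E →L[ℝ] E) = Real.exp s • 1 := by
  ext x
  simp

/-- (Ported verbatim from the HodgeCMPerL package; no docstring in the source.) -/
theorem dilation_add_apply (s t : ℝ) (x : E) : dilation E (s + t) x = dilation E s (dilation E t x) := by
  simp only [dilation_apply, smul_smul, ← Real.exp_add]

/-- (Ported verbatim from the HodgeCMPerL package; no docstring in the source.) -/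
theorem coe_dilation_zero : ((dilation E 0 : E ≃L[ℝ] E) : E →L[ℝ] E) = 1 := by
  rw [coe_dilation, Real.exp_zero, one_smul]

/-- (Ported verbatim from the HodgeCMPerL package; no docstring in the source.) -/
theorem hasDerivAt_coe_dilation :
    HasDerivAt (fun s => ((dilation E s : E ≃L[ℝ] E) : E →L[ℝ] E)) (1 : E →L[ℝ] E) 0 := by
  have h := (Real.hasDerivAt_exp 0).smul_const (1 : E →L[ℝ] E)
  rw [Real.exp_zero, one_smul] at h
  refine h.congr_of_eventuallyEq (Eventually.of_forall fun s => ?_)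
  exact coe_dilation E s

variable {E}

/-- **The Euler operator generates dilations in the Schwartz topology**: for every `Φ ∈ 𝓢(E, F)` and `s₀`,
`s⁻¹ • (Φ(e^{s₀+s} ·) - Φ(e^{s₀} ·)) → (x ↦ DΨ(x)[x])`, `Ψ = Φ(e^{s₀} ·)`, in `𝓢(E, F)`. -/
theorem tendsto_compCLM_dilation_sub_div (𝕜 : Type*) [RCLike 𝕜] [NormedSpace 𝕜 F] [SMulCommClass ℝ 𝕜 F]
    (Φ : 𝓢(E, F)) (s₀ : ℝ) :
    Tendsto (fun s : ℝ => s⁻¹ • (SchwartzMap.compCLMOfContinuousLinearEquiv 𝕜 (dilation E (s₀ + s)) Φ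
        - SchwartzMap.compCLMOfContinuousLinearEquiv 𝕜 (dilation E s₀) Φ)) (𝓝[≠] 0)
      (𝓝 (flowGen (1 : E →L[ℝ] E) (SchwartzMap.compCLMOfContinuousLinearEquiv 𝕜 (dilation E s₀) Φ))) :=
  tendsto_compCLM_sub_div_at 𝕜 (coe_dilation_zero E) (hasDerivAt_coe_dilation E) (dilation_add_apply E) Φ s₀

/-- The Euler operator: `flowGen 1 Φ x = DΦ(x)[x]`. -/
theorem flowGen_one_apply (Φ : 𝓢(E, F)) (x : E) : flowGen (1 : E →L[ℝ] E) Φ x = fderiv ℝ Φ x x := rfl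

end Dilation

end SchwartzWeil
end HodgeCM

-- port_pkg: scope closed for this part
end
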